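import Literature.ModelTheory.ExponentialFields.DefinablyCompleteImplicitFunction
import Literature.ModelTheory.ExponentialFields.DefinablyCompleteChainRule
import HarnessLib

/-!
# The local implicit function theorem (one equation) over a definably complete ordered field

Topic `Literature/ModelTheory/ExponentialFields`.  The classical pointwise form of the
one-equation definable implicit function theorem of `DefinablyCompleteImplicitFunction.lean`
(Fornasiero–Servi 2010, §1.2; van den Dries 1998, Ch. 7, §2): let `F : Kⁿ⁺¹ → K` be
definable, continuous on a sup-ball around `p₀ = (a, b)`, with last partial derivative `q`
there, `q` continuous at `p₀`, `q p₀ ≠ 0` and `F p₀ = 0`.  Then on a box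
`{|x - a|_∞ < r} × [b - s, b + s]` the zero set of `F` is the graph of a definable function
`φ` with `φ a = b`, continuous on the open box, and differentiable wherever `F` is, with the
usual gradient `(-∂ᵢF / ∂_last F)`:

* `IsDefinablyComplete.exists_implicitFunction_of_pos` — the case `q p₀ > 0`;
* **`IsDefinablyComplete.exists_implicitFunction`** — the general case `q p₀ ≠ 0` (apply the
  positive case to `-F`).

Everything is proved; no definitions, no named facts.  Conventions as in the other
definable-calculus files.

## References

* A. Fornasiero, T. Servi, *Definably complete Baire structures*, Fund. Math. 209 (2010),
  §1.2. [FornasieroServi2010]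
* L. van den Dries, *Tame topology and o-minimal structures* (1998), Ch. 7, §2.
  [Dries1998]
-/

open Set Function FirstOrder FirstOrder.Language
open _root_.Filter _root_.Topology

namespace Literature.ModelTheory.ExponentialFields

universe u v

variable {K : Type*} [Field K] [LinearOrder K] [IsStrictOrderedRing K] [TopologicalSpace K]
  [OrderTopology K] {L : FirstOrder.Language.{u, v}} [L.Structure K] {n : ℕ}

/-! ### Topological preliminaries on sup-balls and `Fin.snoc` -/

omit [L.Structure K] in
/-- An open sup-ball is a neighbourhood of each of its points. [folklore] -/
theorem supBall_mem_nhds {m : ℕ} {c x : Fin m → K} {ρ : K} (hx : ∀ i, |x i - c i| < ρ) :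
    {w : Fin m → K | ∀ i, |w i - c i| < ρ} ∈ 𝓝 x := by
  have h : {w : Fin m → K | ∀ i, |w i - c i| < ρ} =
      ⋂ i, (fun w => w i) ⁻¹' Ioo (c i - ρ) (c i + ρ) := by
    ext w
    simp only [mem_setOf_eq, mem_iInter, mem_preimage, mem_Ioo]
    refine forall_congr' fun i => ?_
    rw [abs_sub_lt_iff]
    constructor <;> rintro ⟨h1, h2⟩ <;> constructor <;> linarith
  rw [h]
  refine (Filter.iInter_mem).2 fun i => (continuous_apply i).continuousAt.preimage_mem_nhds ?_
  have hi := abs_sub_lt_iff.1 (hx i)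
  exact Ioo_mem_nhds (by linarith [hi.2]) (by linarith [hi.1])

omit [Field K] [LinearOrder K] [IsStrictOrderedRing K] [OrderTopology K] [L.Structure K] in
/-- `x ↦ snoc x t` is continuous. [folklore] -/
theorem continuous_snoc_left (t : K) :
    Continuous fun x : Fin n → K => (Fin.snoc x t : Fin (n + 1) → K) :=
  Continuous.finSnoc (A := fun _ : Fin (n + 1) => K) continuous_id continuous_const

omit [Field K] [LinearOrder K] [IsStrictOrderedRing K] [OrderTopology K] [L.Structure K] in
/-- `t ↦ snoc x t` is continuous. [folklore] -/
theorem continuous_snoc_right (x : Fin n → K) :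
    Continuous fun t : K => (Fin.snoc x t : Fin (n + 1) → K) :=
  Continuous.finSnoc (A := fun _ : Fin (n + 1) => K) continuous_const continuous_id

omit [IsStrictOrderedRing K] [TopologicalSpace K] [OrderTopology K] [L.Structure K] in
/-- Points `snoc x t` with `|x - a|_∞ < ρ` and `|t - b| < ρ` lie in the sup-ball of radius `ρ`
around `snoc a b`. [folklore] -/
theorem snoc_mem_supBall {a x : Fin n → K} {b t ρ : K} (hx : ∀ i, |x i - a i| < ρ)
    (ht : |t - b| < ρ) : ∀ j, |(Fin.snoc x t : Fin (n + 1) → K) j - (Fin.snoc a b : Fin (n + 1) → K) j| < ρ := by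
  intro j
  induction j using Fin.lastCases with
  | last => simpa only [Fin.snoc_last] using ht
  | cast i => simpa only [Fin.snoc_castSucc] using hx i

/-! ### The local implicit function theorem -/

/-- **The local implicit function theorem, positive case**: let `F : Kⁿ⁺¹ → K` be definable,
continuous at the points of the sup-ball of radius `ρ` around `snoc a b`, with last partial
derivative `q` there, `q` continuous at `snoc a b`, `q (snoc a b) > 0` and `F (snoc a b) = 0`.
Then there are `r, s > 0` and a definable `φ : Kⁿ → K` with `φ a = b` such that for
`|x - a|_∞ < r`: `|φ x - b| < s`, `F (snoc x (φ x)) = 0`, `φ x` is the only zero of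
`t ↦ F (snoc x t)` with `|t - b| ≤ s`, `φ` is continuous at `x`, and `φ` is differentiable at
`x` with gradient `(-gᵢ / g_last)` whenever `F` is differentiable at `snoc x (φ x)` with
gradient `g`, `g_last ≠ 0`. [folklore] -/
theorem _root_.FirstOrder.Language.IsDefinablyComplete.exists_implicitFunction_of_pos
    (hDC : L.IsDefinablyComplete K)
    (hlt : (univ : Set K).Definable L {v : Fin 2 → K | v 0 < v 1})
    (hadd : (univ : Set K).Definable L {v : Fin 3 → K | v 2 = v 0 + v 1})
    (hmul : (univ : Set K).Definable L {v : Fin 3 → K | v 2 = v 0 * v 1})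
    {F : (Fin (n + 1) → K) → K} (hF : (univ : Set K).DefinableFun L F)
    {q : (Fin (n + 1) → K) → K} {a : Fin n → K} {b ρ : K} (hρ : 0 < ρ)
    (hcont : ∀ p : Fin (n + 1) → K, (∀ j, |p j - (Fin.snoc a b : Fin (n + 1) → K) j| < ρ) → ContinuousAt F p)
    (hder : ∀ p : Fin (n + 1) → K, (∀ j, |p j - (Fin.snoc a b : Fin (n + 1) → K) j| < ρ) →
      HasPartialDerivAt F (Fin.last n) (q p) p)
    (hqc : ContinuousAt q (Fin.snoc a b)) (hq : 0 < q (Fin.snoc a b)) (hF0 : F (Fin.snoc a b) = 0) :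
    ∃ r s : K, 0 < r ∧ 0 < s ∧ ∃ φ : (Fin n → K) → K, (univ : Set K).DefinableFun L φ ∧
      φ a = b ∧
      ∀ x : Fin n → K, (∀ i, |x i - a i| < r) →
        |φ x - b| < s ∧ F (Fin.snoc x (φ x)) = 0 ∧
        (∀ t, |t - b| ≤ s → F (Fin.snoc x t) = 0 → t = φ x) ∧
        ContinuousAt φ x ∧
        ∀ g : Fin (n + 1) → K, HasLinDerivAt F g (Fin.snoc x (φ x)) → g (Fin.last n) ≠ 0 →
          HasLinDerivAt φ (fun i => -g (Fin.castSucc i) / g (Fin.last n)) x := by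
  classical
  -- (1) a radius `ρ₁ ≤ ρ` on which `q > 0`
  obtain ⟨ρ₁, hρ₁, hρ₁ρ, hqpos⟩ : ∃ ρ₁ : K, 0 < ρ₁ ∧ ρ₁ ≤ ρ ∧
      ∀ p : Fin (n + 1) → K, (∀ j, |p j - (Fin.snoc a b : Fin (n + 1) → K) j| < ρ₁) → 0 < q p := by
    have hev : ∀ᶠ p in 𝓝 (Fin.snoc a b : Fin (n + 1) → K), q (Fin.snoc a b) / 2 < q p :=
      hqc.eventually (eventually_gt_nhds (half_lt_self hq))
    obtain ⟨ρ', hρ', hρ't⟩ := exists_pos_forall_abs_sub_lt_subset_of_mem_nhds hev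
    refine ⟨min ρ' ρ, lt_min hρ' hρ, min_le_right _ _, fun p hp => ?_⟩
    have h := hρ't p fun j => (hp j).trans_le (min_le_left _ _)
    exact (half_pos hq).trans h
  -- (2) `s = ρ₁ / 2`; the fibre at `a` on `[b - s, b + s]`
  set s : K := ρ₁ / 2 with hs
  have hspos : 0 < s := half_pos hρ₁
  have hsρ₁ : s < ρ₁ := half_lt_self hρ₁
  have hin : ∀ x : Fin n → K, (∀ i, |x i - a i| < s) → ∀ t, |t - b| < ρ₁ →
      ∀ j, |(Fin.snoc x t : Fin (n + 1) → K) j - (Fin.snoc a b : Fin (n + 1) → K) j| < ρ₁ :=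
    fun x hx t ht => snoc_mem_supBall (fun i => (hx i).trans hsρ₁) ht
  have hIcc : ∀ t, t ∈ Icc (b - s) (b + s) → |t - b| < ρ₁ := fun t ht =>
    lt_of_le_of_lt (abs_le.2 ⟨by linarith [ht.1], by linarith [ht.2]⟩) hsρ₁
  -- fibres over the `s`-ball: continuous and strictly increasing on `[b - s, b + s]`
  have hfib_cont : ∀ x : Fin n → K, (∀ i, |x i - a i| < s) →
      ContinuousOn (fun t => F (Fin.snoc x t)) (Icc (b - s) (b + s)) := by
    intro x hx t ht
    have h1 : ContinuousAt F (Fin.snoc x t) :=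
      hcont _ fun j => (hin x hx t (hIcc t ht) j).trans_le hρ₁ρ
    exact (h1.comp (continuous_snoc_right x).continuousAt).continuousWithinAt
  have hfib_mono : ∀ x : Fin n → K, (∀ i, |x i - a i| < s) →
      StrictMonoOn (fun t => F (Fin.snoc x t)) (Icc (b - s) (b + s)) := by
    intro x hx
    refine hDC.strictMonoOn_snoc hlt hadd hmul hF (q := q) (hfib_cont x hx) ?_ ?_
    · intro t ht
      exact hder _ fun j => (hin x hx t (hIcc t ⟨ht.1.le, ht.2.le⟩) j).trans_le hρ₁ρ
    · intro t ht
      exact hqpos _ (hin x hx t (hIcc t ⟨ht.1.le, ht.2.le⟩))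
  -- signs at `a`
  have ha0 : ∀ i, |a i - a i| < s := fun i => by simpa using hspos
  have hbI : b ∈ Icc (b - s) (b + s) := ⟨by linarith, by linarith⟩
  have hloI : b - s ∈ Icc (b - s) (b + s) := ⟨le_rfl, by linarith⟩
  have hhiI : b + s ∈ Icc (b - s) (b + s) := ⟨by linarith, le_rfl⟩
  have h1 : F (Fin.snoc a (b - s)) < 0 := by
    have h := hfib_mono a ha0 hloI hbI (by linarith)
    simpa only [hF0] using h
  have h2 : 0 < F (Fin.snoc a (b + s)) := by
    have h := hfib_mono a ha0 hbI hhiI (by linarith)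
    simpa only [hF0] using h
  -- (3) a radius `r ≤ s` on which the signs persist
  obtain ⟨r, hr, hrs, hsign⟩ : ∃ r : K, 0 < r ∧ r ≤ s ∧ ∀ x : Fin n → K, (∀ i, |x i - a i| < r) →
      F (Fin.snoc x (b - s)) < 0 ∧ 0 < F (Fin.snoc x (b + s)) := by
    have hc1 : ContinuousAt (fun x : Fin n → K => F (Fin.snoc x (b - s))) a :=
      ContinuousAt.comp_of_eq (hcont _ fun j => (hin a ha0 _ (hIcc _ hloI) j).trans_le hρ₁ρ)
        (continuous_snoc_left (b - s)).continuousAt rfl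
    have hc2 : ContinuousAt (fun x : Fin n → K => F (Fin.snoc x (b + s))) a :=
      ContinuousAt.comp_of_eq (hcont _ fun j => (hin a ha0 _ (hIcc _ hhiI) j).trans_le hρ₁ρ)
        (continuous_snoc_left (b + s)).continuousAt rfl
    have hev : ∀ᶠ x in 𝓝 a, F (Fin.snoc x (b - s)) < 0 ∧ 0 < F (Fin.snoc x (b + s)) :=
      (hc1.eventually (eventually_lt_nhds h1)).and (hc2.eventually (eventually_gt_nhds h2))
    obtain ⟨r', hr', hr't⟩ := exists_pos_forall_abs_sub_lt_subset_of_mem_nhds hev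
    exact ⟨min r' s, lt_min hr' hspos, min_le_right _ _, fun x hx =>
      hr't x fun i => (hx i).trans_le (min_le_left _ _)⟩
  -- (4) the definable implicit function over `U = {|x - a|_∞ < r}`
  set U : Set (Fin n → K) := {x | ∀ i, |x i - a i| < r} with hU
  have hUs : ∀ x ∈ U, ∀ i, |x i - a i| < s := fun x hx i => (hx i).trans_le hrs
  have hUdef : (univ : Set K).Definable L U := by
    have h := definable_iInter_of_finite (L := L) (A := (univ : Set K)) fun i : Fin n =>
      (definable_setOf_lt_params hlt (definableFun_const_params _ (mem_univ (a i - r)))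
        (definableFun_proj_params (α := Fin n) i)).inter
      (definable_setOf_lt_params hlt (definableFun_proj_params (α := Fin n) i)
        (definableFun_const_params _ (mem_univ (a i + r))))
    refine (congrArg _ ?_).mpr h
    ext x
    simp only [hU, mem_setOf_eq, mem_iInter, mem_inter_iff]
    refine forall_congr' fun i => ?_
    rw [abs_sub_lt_iff]
    constructor <;> rintro ⟨h1, h2⟩ <;> constructor <;> linarith
  have hcd : b - s ≤ b + s := by linarith
  obtain ⟨φ, hφdef, -, hφ⟩ := hDC.exists_definableFun_implicit hlt hF hUdef hcd
    (fun x hx => hfib_cont x (hUs x hx)) (fun x hx => hfib_mono x (hUs x hx))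
    (fun x hx => (hsign x hx).1) (fun x hx => (hsign x hx).2)
  -- uniqueness on `[b - s, b + s]`
  have huniq : ∀ x ∈ U, ∀ t, |t - b| ≤ s → F (Fin.snoc x t) = 0 → t = φ x := by
    intro x hx t ht h0
    have htI : t ∈ Icc (b - s) (b + s) := ⟨by linarith [(abs_le.1 ht).1], by linarith [(abs_le.1 ht).2]⟩
    have hφI : φ x ∈ Icc (b - s) (b + s) := ⟨(hφ x hx).1.1.le, (hφ x hx).1.2.le⟩
    refine (hfib_mono x (hUs x hx)).injOn htI hφI ?_
    show F (Fin.snoc x t) = F (Fin.snoc x (φ x))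
    rw [h0, (hφ x hx).2]
  have haU : a ∈ U := fun i => by simpa using hr
  refine ⟨r, s, hr, hspos, φ, hφdef, (huniq a haU b (by simpa using hspos.le) hF0).symm, ?_⟩
  intro x hx
  have hxU : x ∈ U := hx
  have hUn : U ∈ 𝓝 x := supBall_mem_nhds hx
  have hφx := hφ x hxU
  have hcontφ : ContinuousAt φ x := by
    refine continuousAt_implicit (F := F) hUn (fun x' hx' => hfib_mono x' (hUs x' hx')) hφ ?_
    intro t ht
    exact ContinuousAt.comp_of_eq
      (hcont _ fun j => (hin x (hUs x hxU) t (hIcc t ht) j).trans_le hρ₁ρ)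
      (continuous_snoc_left t).continuousAt rfl
  refine ⟨?_, hφx.2, fun t ht h0 => huniq x hxU t ht h0, hcontφ, fun g hg hgl => ?_⟩
  · have h := hφx.1
    rw [abs_sub_lt_iff]
    constructor <;> linarith [h.1, h.2]
  · refine hg.implicit hgl hcontφ ?_
    filter_upwards [hUn] with x' hx' using (hφ x' hx').2

/-- **The local implicit function theorem** (one equation): as
`exists_implicitFunction_of_pos`, with `q (snoc a b) ≠ 0` of either sign (for `q < 0` apply
the positive case to `-F`, whose graph is definable when that of `+` is). [folklore] -/
theorem _root_.FirstOrder.Language.IsDefinablyComplete.exists_implicitFunction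
    (hDC : L.IsDefinablyComplete K)
    (hlt : (univ : Set K).Definable L {v : Fin 2 → K | v 0 < v 1})
    (hadd : (univ : Set K).Definable L {v : Fin 3 → K | v 2 = v 0 + v 1})
    (hmul : (univ : Set K).Definable L {v : Fin 3 → K | v 2 = v 0 * v 1})
    {F : (Fin (n + 1) → K) → K} (hF : (univ : Set K).DefinableFun L F)
    {q : (Fin (n + 1) → K) → K} {a : Fin n → K} {b ρ : K} (hρ : 0 < ρ)
    (hcont : ∀ p : Fin (n + 1) → K, (∀ j, |p j - (Fin.snoc a b : Fin (n + 1) → K) j| < ρ) → ContinuousAt F p)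
    (hder : ∀ p : Fin (n + 1) → K, (∀ j, |p j - (Fin.snoc a b : Fin (n + 1) → K) j| < ρ) →
      HasPartialDerivAt F (Fin.last n) (q p) p)
    (hqc : ContinuousAt q (Fin.snoc a b)) (hq : q (Fin.snoc a b) ≠ 0)
    (hF0 : F (Fin.snoc a b) = 0) :
    ∃ r s : K, 0 < r ∧ 0 < s ∧ ∃ φ : (Fin n → K) → K, (univ : Set K).DefinableFun L φ ∧
      φ a = b ∧
      ∀ x : Fin n → K, (∀ i, |x i - a i| < r) →
        |φ x - b| < s ∧ F (Fin.snoc x (φ x)) = 0 ∧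
        (∀ t, |t - b| ≤ s → F (Fin.snoc x t) = 0 → t = φ x) ∧
        ContinuousAt φ x ∧
        ∀ g : Fin (n + 1) → K, HasLinDerivAt F g (Fin.snoc x (φ x)) → g (Fin.last n) ≠ 0 →
          HasLinDerivAt φ (fun i => -g (Fin.castSucc i) / g (Fin.last n)) x := by
  rcases lt_or_gt_of_ne hq with hneg | hpos
  · -- apply the positive case to `-F`
    have hnegdef : (univ : Set K).Definable L {v : Fin 2 → K | v 1 = (fun s => -s) (v 0)} :=
      definable_graph_neg hadd (f := fun s => s)
        (definable_setOf_eq_params (definableFun_proj_params 1) (definableFun_proj_params 0))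
    have hF' : (univ : Set K).DefinableFun L fun p => -F p :=
      definableFun_apply_params (f := fun s => -s) hnegdef hF
    have hcont' : ∀ p : Fin (n + 1) → K, (∀ j, |p j - (Fin.snoc a b : Fin (n + 1) → K) j| < ρ) →
        ContinuousAt (fun p => -F p) p := fun p hp => (hcont p hp).neg
    have hder' : ∀ p : Fin (n + 1) → K, (∀ j, |p j - (Fin.snoc a b : Fin (n + 1) → K) j| < ρ) →
        HasPartialDerivAt (fun p => -F p) (Fin.last n) ((fun p => -q p) p) p := by
      intro p hp
      have h := hder p hp
      rw [hasPartialDerivAt_iff] at h ⊢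
      exact h.neg
    have hqc' : ContinuousAt (fun p => -q p) (Fin.snoc a b) := hqc.neg
    have hq' : 0 < (fun p => -q p) (Fin.snoc a b) := by simpa using hneg
    have hF0' : (fun p => -F p) (Fin.snoc a b) = 0 := by simpa using hF0
    obtain ⟨r, s, hr, hs, φ, hφdef, hφa, hφ⟩ := hDC.exists_implicitFunction_of_pos hlt hadd hmul
      hF' hρ hcont' hder' hqc' hq' hF0'
    refine ⟨r, s, hr, hs, φ, hφdef, hφa, fun x hx => ?_⟩
    obtain ⟨h1, h2, h3, h4, h5⟩ := hφ x hx
    refine ⟨h1, by simpa using h2, fun t ht h0 => h3 t ht (by simpa using h0), h4, fun g hg hgl => ?_⟩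
    have hg' : HasLinDerivAt (fun p => -F p) (fun j => -g j) (Fin.snoc x (φ x)) := by
      have h := hg.const_mul (-1)
      simpa using h
    have h := h5 (fun j => -g j) hg' (by simpa using hgl)
    beta_reduce at h
    simp only [neg_div_neg_eq] at h
    exact h
  · exact hDC.exists_implicitFunction_of_pos hlt hadd hmul hF hρ hcont hder hqc hpos hF0

end Literature.ModelTheory.ExponentialFields
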